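import Literature.Geometry.Symplectic.PALFCollarProduct
import Literature.Geometry.Symplectic.PALFRegularFibre
import Literature.Topology.FourManifolds.RegularFibreTangent
import Literature.Topology.FourManifolds.MorseRelCompact
import HarnessLib

/-!
# A Morse function on the regular fibre of a PALF with a prescribed collar profile

Topic `Literature/Geometry/Symplectic` (fact seat
`provefact-Literature.Geometry.Symplectic.Oba2016_s-add47373d4`; Kas' handle count — Kas 1980 §2,
Gompf–Stipsicz 1999 §8.2: the Morse function `A ∘ f + B` on the total space uses a Morse
function `B` of the fibre; near the horizontal boundary it must be a fixed function of a collar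
coordinate `σ` of `∂W`).  Everything is proved; no definitions, no named facts.

For a PALF `P` on the compact `W`, a flow-out input `D` (`σ = D.f`), a regular value `c₀` with
`‖c₀‖ ≤ r < 1`, the fibre manifold `F° = RegularFibreOn (P.isRegularFibreOn_interior hc)`
(`PALFRegularFibre.lean`) and the collar coordinate `τ = σ ∘ incl : F° → ℝ`:

* `exists_pos_forall_not_isMCriticalPt_tau` — `τ` has no critical point on `{τ < s₁}` for some
  `s₁ > 0` (the kernel field `ν` of `PALFInwardFields.lean` is tangent to the fibre,
  `Literature.Topology.FourManifolds.RegularFibreOn.exists_mfderiv_incl_eq`, and `dσ(ν) > 0` there,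
  `PALF.exists_pos_forall_mlineDeriv_pos`);
* `isCompact_tau_preimage_Icc`, `isCompact_tau_preimage_Ici` — the pieces `{c ≤ τ ≤ c'}`,
  `{c ≤ τ}` of the fibre (`c > 0`) are compact;
* `exists_fibreMorse` — **the fibre Morse function with collar profile**: for `0 < c`,
  `2c < s₁` and a smooth profile `b < 1` with `b' ≠ 0` on `(-∞, 2c)`, there is a Morse function
  `m` on `F°` with `m = b ∘ τ` on `{τ ≤ c}` and all critical points in `{τ > 3c/2}`
  (`Literature.Topology.FourManifolds.exists_morse_perturbation_rel` with `Cl = τ⁻¹[c, 3c/2]`,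
  `K = τ⁻¹[3c/2, ∞)`, `O = {τ > c}`).

## References

* A. Kas, *On the handlebody decomposition associated to a Lefschetz fibration*, Pacific J.
  Math. 89 (1980), §2. [Kas1980]
* R. E. Gompf, A. I. Stipsicz, *4-Manifolds and Kirby Calculus*, GSM 20 (1999), §8.2.
  [GompfStipsiczGSM1999]
* J. Milnor, *Lectures on the h-cobordism theorem*, Princeton (1965), §2 Thm. 2.7.
  [MilnorHCobordism1965]
-/

open scoped Manifold ContDiff Topology
open Set Function Filter

noncomputable section

namespace Literature.Geometry.Symplectic

open Literature.Topology.FourManifolds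

universe u

variable {W : Type u} [TopologicalSpace W] [ChartedSpace (EuclideanHalfSpace 4) W]
  [IsManifold (𝓡∂ 4) ∞ W] [T2Space W] [CompactSpace W]
  {o : SmoothOrientation (𝓡∂ 4) W} {b : BoundaryData (𝓡∂ 4) W (𝓡 3)} (P : PALF o b)

namespace PALF

/-! ### The collar coordinate on the fibre -/

omit [T2Space W] [CompactSpace W] in
/-- The collar coordinate `τ = σ ∘ incl` of the fibre is smooth. [folklore] -/
theorem contMDiff_tau (D : FlowoutInput 3 W) {c₀ : EuclideanSpace ℝ (Fin 2)} (hc : c₀ ∉ P.f '' ↑P.crit) :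
    ContMDiff (𝓡 2) 𝓘(ℝ, ℝ) ∞
      fun q : RegularFibreOn (P.isRegularFibreOn_interior hc) =>
        D.f (RegularFibreOn.incl (P.isRegularFibreOn_interior hc) q) :=
  D.f_smooth.comp (RegularFibreOn.contMDiff_incl _)

/-- **`τ` is regular near the end of the fibre**: there is `s₁ > 0` such that `τ = σ ∘ incl`
has no critical point at the points of `F°` with `τ < s₁` — the kernel field `ν` is tangent to
the fibre and `dσ(ν) > 0` there. [cite: Kas1980, §2] -/
theorem exists_pos_forall_not_isMCriticalPt_tau (D : FlowoutInput 3 W) {c₀ : EuclideanSpace ℝ (Fin 2)}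
    (hc : c₀ ∉ P.f '' ↑P.crit) {r : ℝ} (hc₀r : ‖c₀‖ ≤ r) (hr : r < 1) :
    ∃ s₁ : ℝ, 0 < s₁ ∧ ∀ q : RegularFibreOn (P.isRegularFibreOn_interior hc),
      D.f (RegularFibreOn.incl (P.isRegularFibreOn_interior hc) q) < s₁ →
        ¬ IsMCriticalPt (𝓡 2)
          (fun q : RegularFibreOn (P.isRegularFibreOn_interior hc) =>
            D.f (RegularFibreOn.incl (P.isRegularFibreOn_interior hc) q)) q := by
  set hF := P.isRegularFibreOn_interior hc
  obtain ⟨ν, hνs, -, hνk, hνin⟩ := P.exists_kernel_field_inward hr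
  obtain ⟨s₁, hs₁, hs₁ν⟩ := P.exists_pos_forall_mlineDeriv_pos D hνs hνin
  refine ⟨s₁, hs₁, fun q hq hcrit => ?_⟩
  set x := RegularFibreOn.incl hF q with hx
  have hfx : P.f x = c₀ := RegularFibreOn.apply_incl hF q
  have hxr : ‖P.f x‖ ≤ r := by rw [hfx]; exact hc₀r
  have hpos : 0 < mlineDeriv (𝓡∂ 4) D.f x (ν x) := hs₁ν x hxr hq
  -- `ν x` is tangent to the fibre
  obtain ⟨w, hw⟩ := RegularFibreOn.exists_mfderiv_incl_eq hF q (v := ν x) (hνk x hxr)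
  -- chain rule for `τ = σ ∘ incl`
  have hσ : MDifferentiableAt (𝓡∂ 4) 𝓘(ℝ, ℝ) D.f (RegularFibreOn.incl hF q) :=
    D.f_smooth.mdifferentiableAt (by simp)
  have hi : MDifferentiableAt (𝓡 2) (𝓡∂ 4) (RegularFibreOn.incl hF) q :=
    (RegularFibreOn.contMDiff_incl hF).mdifferentiableAt (by simp)
  have h1 := mfderiv_comp q hσ hi
  unfold IsMCriticalPt at hcrit
  have h2 : mfderiv (𝓡 2) 𝓘(ℝ, ℝ) (D.f ∘ RegularFibreOn.incl hF) q = 0 := hcrit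
  have h3 := ContinuousLinearMap.ext_iff.1 (h1.symm.trans h2) w
  have h4 : mfderiv (𝓡∂ 4) 𝓘(ℝ, ℝ) D.f (RegularFibreOn.incl hF q)
      (mfderiv (𝓡 2) (𝓡∂ 4) (RegularFibreOn.incl hF) q w) = 0 := h3
  rw [hw] at h4
  rw [mlineDeriv_def] at hpos
  exact hpos.ne' h4

omit [T2Space W] in
/-- The piece `{c ≤ τ ≤ c'}` of the fibre is compact for `c > 0`. [folklore] -/
theorem isCompact_tau_preimage_Icc (D : FlowoutInput 3 W) {c₀ : EuclideanSpace ℝ (Fin 2)}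
    (hc : c₀ ∉ P.f '' ↑P.crit) {c c' : ℝ} (hc0 : 0 < c) :
    IsCompact {q : RegularFibreOn (P.isRegularFibreOn_interior hc) |
      D.f (RegularFibreOn.incl (P.isRegularFibreOn_interior hc) q) ∈ Icc c c'} := by
  set hF := P.isRegularFibreOn_interior hc
  set K : Set W := P.f ⁻¹' {c₀} ∩ D.f ⁻¹' Icc c c' with hK
  have hKc : IsCompact K :=
    ((isClosed_singleton.preimage P.contMDiff.continuous).inter
      (isClosed_Icc.preimage D.f_smooth.continuous)).isCompact
  have hKF : K ⊆ P.f ⁻¹' {c₀} ∩ (𝓡∂ 4).interior W := by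
    rintro x ⟨hx1, hx2⟩
    refine ⟨hx1, ?_⟩
    by_contra h
    have hb : x ∈ (𝓡∂ 4).boundary W := ((𝓡∂ 4).isInteriorPoint_or_isBoundaryPoint x).resolve_left h
    have := (D.f_eq_zero_iff x).2 hb
    have h2 := hx2.1
    rw [this] at h2
    linarith
  have h := RegularFibreOn.isCompact_preimage_incl hF hKc hKF
  convert h using 1
  ext q
  simp only [mem_setOf_eq, mem_preimage, hK, mem_inter_iff, mem_singleton_iff, RegularFibreOn.apply_incl,
    true_and]

omit [T2Space W] in
/-- The piece `{c ≤ τ}` of the fibre is compact for `c > 0`. [folklore] -/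
theorem isCompact_tau_preimage_Ici (D : FlowoutInput 3 W) {c₀ : EuclideanSpace ℝ (Fin 2)}
    (hc : c₀ ∉ P.f '' ↑P.crit) {c : ℝ} (hc0 : 0 < c) :
    IsCompact {q : RegularFibreOn (P.isRegularFibreOn_interior hc) |
      c ≤ D.f (RegularFibreOn.incl (P.isRegularFibreOn_interior hc) q)} := by
  set hF := P.isRegularFibreOn_interior hc
  set K : Set W := P.f ⁻¹' {c₀} ∩ D.f ⁻¹' Ici c with hK
  have hKc : IsCompact K :=
    ((isClosed_singleton.preimage P.contMDiff.continuous).inter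
      (isClosed_Ici.preimage D.f_smooth.continuous)).isCompact
  have hKF : K ⊆ P.f ⁻¹' {c₀} ∩ (𝓡∂ 4).interior W := by
    rintro x ⟨hx1, hx2⟩
    refine ⟨hx1, ?_⟩
    by_contra h
    have hb : x ∈ (𝓡∂ 4).boundary W := ((𝓡∂ 4).isInteriorPoint_or_isBoundaryPoint x).resolve_left h
    have := (D.f_eq_zero_iff x).2 hb
    have h2 : c ≤ D.f x := hx2
    rw [this] at h2
    linarith
  have h := RegularFibreOn.isCompact_preimage_incl hF hKc hKF
  convert h using 1
  ext q
  simp only [mem_setOf_eq, mem_preimage, hK, mem_inter_iff, mem_singleton_iff, RegularFibreOn.apply_incl,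
    true_and, mem_Ici]

/-! ### The fibre Morse function -/

/-- **A Morse function on the regular fibre with a prescribed collar profile** (Kas 1980 §2:
the function `B` of the fibre; here on the non-compact fibre manifold `F°`, with the profile
`b ∘ τ` frozen near the end).  Let `s₁ > 0` be such that `τ = σ ∘ incl` is regular on
`{τ < s₁}`, `0 < c`, `2c < s₁`, and `b : ℝ → ℝ` smooth with `b < 1` and `b' ≠ 0` on
`(-∞, 2c)`.  Then there is a Morse function `m : F° → ℝ` with `m = b ∘ τ` on `{τ ≤ c}`, all of
whose critical points lie in `{τ > 3c/2}`. [cite: Kas1980, §2] [cite: MilnorHCobordism1965, §2 Thm. 2.7] -/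
theorem exists_fibreMorse (D : FlowoutInput 3 W) {c₀ : EuclideanSpace ℝ (Fin 2)} (hc : c₀ ∉ P.f '' ↑P.crit)
    {s₁ : ℝ}
    (hs₁ : ∀ q : RegularFibreOn (P.isRegularFibreOn_interior hc),
      D.f (RegularFibreOn.incl (P.isRegularFibreOn_interior hc) q) < s₁ →
        ¬ IsMCriticalPt (𝓡 2)
          (fun q : RegularFibreOn (P.isRegularFibreOn_interior hc) =>
            D.f (RegularFibreOn.incl (P.isRegularFibreOn_interior hc) q)) q)
    {c : ℝ} (hc0 : 0 < c) (hcs : 2 * c < s₁)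
    {bb : ℝ → ℝ} (hb : ContDiff ℝ ∞ bb) (hb1 : ∀ t, bb t < 1) (hb' : ∀ t, t < 2 * c → deriv bb t ≠ 0) :
    ∃ m : RegularFibreOn (P.isRegularFibreOn_interior hc) → ℝ,
      IsMorse (𝓡 2) m ∧
      (∀ q, D.f (RegularFibreOn.incl (P.isRegularFibreOn_interior hc) q) ≤ c →
        m q = bb (D.f (RegularFibreOn.incl (P.isRegularFibreOn_interior hc) q))) ∧
      ∀ q, IsMCriticalPt (𝓡 2) m q →
        3 * c / 2 < D.f (RegularFibreOn.incl (P.isRegularFibreOn_interior hc) q) := by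
  set hF := P.isRegularFibreOn_interior hc
  set τ : RegularFibreOn hF → ℝ := fun q => D.f (RegularFibreOn.incl hF q) with hτ
  have hτs : ContMDiff (𝓡 2) 𝓘(ℝ, ℝ) ∞ τ := P.contMDiff_tau D hc
  haveI : LocallyCompactSpace (RegularFibreOn hF) :=
    ChartedSpace.locallyCompactSpace (EuclideanSpace ℝ (Fin 2)) (RegularFibreOn hF)
  -- the initial function `f₀ = bb ∘ τ`
  set f₀ : RegularFibreOn hF → ℝ := fun q => bb (τ q) with hf₀
  have hf₀s : ContMDiff (𝓡 2) 𝓘(ℝ, ℝ) ∞ f₀ := hb.comp_contMDiff hτs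
  have hf₀reg : ∀ q, τ q < 2 * c → ¬ IsMCriticalPt (𝓡 2) f₀ q := by
    intro q hq h
    have hd : HasDerivAt bb (deriv bb (τ q)) (τ q) :=
      (hb.differentiable (by simp)).differentiableAt.hasDerivAt
    have h' := (isMCriticalPt_comp_iff_of_hasDerivAt (I := 𝓡 2) (σ := bb) (g := τ) hd (hb' _ hq)
      (hτs.mdifferentiableAt (by simp))).1 h
    exact hs₁ q (by linarith) h'
  -- the compact pieces and the open set
  set Cl : Set (RegularFibreOn hF) := {q | τ q ∈ Icc c (3 * c / 2)} with hCl
  have hClc : IsCompact Cl := P.isCompact_tau_preimage_Icc D hc (c' := 3 * c / 2) hc0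
  set K : Set (RegularFibreOn hF) := {q | 3 * c / 2 ≤ τ q} with hK
  have hKc : IsCompact K := P.isCompact_tau_preimage_Ici D hc (c := 3 * c / 2) (by linarith)
  set O : Set (RegularFibreOn hF) := {q | c < τ q} with hO
  have hOo : IsOpen O := isOpen_lt continuous_const hτs.continuous
  have hKO : K ⊆ O := fun q hq => by
    simp only [hK, hO, mem_setOf_eq] at hq ⊢; linarith
  obtain ⟨g, hg, -, ⟨V, hVo, hOV, hVeq⟩, hgreg, hgnd⟩ :=
    exists_morse_perturbation_rel (I := 𝓡 2) hf₀s (fun q _ => hb1 _) hClc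
      (fun q hq => hf₀reg q (by simp only [hCl, mem_setOf_eq, mem_Icc] at hq; linarith))
      hKc (fun q _ => BoundarylessManifold.isInteriorPoint) hOo hKO
  -- the critical points of `g`
  have hcrit : ∀ q, IsMCriticalPt (𝓡 2) g q → 3 * c / 2 < τ q := by
    intro q hq
    by_contra hle
    replace hle : τ q ≤ 3 * c / 2 := not_lt.1 hle
    rcases lt_or_ge (τ q) c with h1 | h1
    · -- below `c`: `g = f₀` near `q`, and `f₀` is regular there
      have hqV : q ∈ V := hOV (fun h => absurd h (by simp only [hO, mem_setOf_eq, not_lt]; exact h1.le))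
      have hev : g =ᶠ[𝓝 q] f₀ := by
        filter_upwards [hVo.mem_nhds hqV] with q' hq' using hVeq q' hq'
      have hq' : IsMCriticalPt (𝓡 2) f₀ q := by
        unfold IsMCriticalPt at hq ⊢
        rw [← hev.mfderiv_eq]; exact hq
      exact hf₀reg q (by linarith) hq'
    · exact hgreg q ⟨h1, hle⟩ hq
  refine ⟨g, ⟨hg, fun q hq => hgnd q (hcrit q hq).le hq⟩, fun q hq => ?_, hcrit⟩
  exact hVeq q (hOV fun h => absurd h (by simp only [hO, mem_setOf_eq, not_lt]; exact hq))

end PALF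

end Literature.Geometry.Symplectic

end
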